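import Summits.Ventures.PercRepro.Night2T3Corank4

/-!
# PercRepro — the type-`3` balance at corank `5` (night-2, NIGHT-2-t3.md §7.1, the case `d = 5` for every `q`)

The lower counterpart of the up-degree bound: on a simple matroid every spanning non-basis `S` of `G` has at most
`q − 2` coloops, so at least `|S| − q + 2 = d − j + 2` of its points `x` keep `S ∖ x` spanning (`j = |G ∖ S|`); the
pairs `(S, x)` map bijectively onto the pairs `(S ∖ x, x)` with `S ∖ x ∈ C_{j+1}`, whence
`(j + 1)·#C_{j+1} ≥ (d − j + 2)·#C_j` for `j + 1 ≤ d` (`succ_mul_card_ge`).  At corank `5` the size form has the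
terms `2j − 8`; the bounds `#C_1 ≥ 7`, `#C_2 ≥ 3·#C_1`, `#C_4 ≥ #C_3`, `5·#C_5 ≥ 3·#C_4` (lower) and
`3·#C_3 ≤ (q + 3)·#C_2` (upper) close the balance for every `q ≥ 4`.  Imports `Night2T3Corank4` only.
-/
namespace PercRepro.Star

open Finset ThmH SixFour GenQ

variable {α : Type*} [DecidableEq α] {M : Matroid α} [M.Finite]

/-- For `x ∈ G`, the sets `S ∈ R_q(G)` with `|G ∖ S| = j` in which `x` is a non-coloop are in bijection with the
sets `S′ ∈ R_q(G)` with `|G ∖ S′| = j + 1` avoiding `x` (`S ↦ S ∖ x`). -/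
theorem card_filter_nonColoop_eq {G : Finset α} {q : ℕ} (hrG : M.eRk (G : Set α) = (q : ℕ∞)) {x : α}
    (hxG : x ∈ G) (j : ℕ) :
    ((Rq M G q).filter (fun S : Finset α =>
        (G \ S).card = j ∧ x ∈ S ∧ M.eRk ((S.erase x : Finset α) : Set α) = (q : ℕ∞))).card =
      ((Rq M G q).filter (fun S : Finset α => (G \ S).card = j + 1 ∧ x ∉ S)).card := by
  refine Finset.card_bij' (fun S _ => S.erase x) (fun S _ => insert x S) ?hi ?hj ?li ?ri
  case hi =>
    intro S hS
    rw [Finset.mem_filter, mem_Rq] at hS ⊢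
    refine ⟨⟨(Finset.erase_subset x S).trans hS.1.1, hS.2.2.2⟩, ?_, Finset.notMem_erase x S⟩
    have h1 : G \ S.erase x = insert x (G \ S) := by
      ext y
      simp only [Finset.mem_sdiff, Finset.mem_erase, Finset.mem_insert, not_and]
      constructor
      · rintro ⟨hyG, h⟩
        by_cases hyx : y = x
        · exact Or.inl hyx
        · exact Or.inr ⟨hyG, h hyx⟩
      · rintro (rfl | ⟨hyG, hyS⟩)
        · exact ⟨hxG, fun h _ => h rfl⟩
        · exact ⟨hyG, fun _ => hyS⟩
    have h2 : x ∉ G \ S := by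
      simp only [Finset.mem_sdiff, not_and, not_not]
      exact fun _ => hS.2.2.1
    rw [h1, Finset.card_insert_of_notMem h2, hS.2.1]
  case hj =>
    intro S hS
    rw [Finset.mem_filter, mem_Rq] at hS ⊢
    have hsub : insert x S ⊆ G := Finset.insert_subset hxG hS.1.1
    have hr : M.eRk ((insert x S : Finset α) : Set α) = (q : ℕ∞) := by
      apply le_antisymm
      · rw [← hrG]
        exact M.eRk_mono (Finset.coe_subset.2 hsub)
      · rw [← hS.1.2]
        exact M.eRk_mono (Finset.coe_subset.2 (Finset.subset_insert x S))
    refine ⟨⟨hsub, hr⟩, ?_, Finset.mem_insert_self x S, ?_⟩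
    · have h1 : G \ S = insert x (G \ insert x S) := by
        ext y
        simp only [Finset.mem_sdiff, Finset.mem_insert]
        constructor
        · rintro ⟨hyG, hyS⟩
          by_cases hyx : y = x
          · exact Or.inl hyx
          · exact Or.inr ⟨hyG, fun h => h.elim (fun h' => hyx h') hyS⟩
        · rintro (rfl | ⟨hyG, hy⟩)
          · exact ⟨hxG, hS.2.2⟩
          · exact ⟨hyG, fun h => hy (Or.inr h)⟩
      have h2 : x ∉ G \ insert x S := by
        simp only [Finset.mem_sdiff, Finset.mem_insert, true_or, not_true_eq_false, and_false,
          not_false_eq_true]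
      have h3 := Finset.card_insert_of_notMem h2
      rw [← h1, hS.2.1] at h3
      omega
    · rw [Finset.erase_insert hS.2.2]
      exact hS.1.2
  case li =>
    intro S hS
    have hS' := Finset.mem_filter.1 hS
    exact Finset.insert_erase hS'.2.2.1
  case ri =>
    intro S hS
    have hS' := Finset.mem_filter.1 hS
    exact Finset.erase_insert hS'.2.2

/-- `Σ_{S ∈ C_j} (|S| − m(S)) = (j + 1)·#C_{j+1}`: the non-coloop pairs of the `j`-complement sets are the
point-complement pairs of the `(j + 1)`-complement sets. -/
theorem sum_card_sub_mTr_eq_succ_mul_card {G : Finset α} {q : ℕ} (hG : G ⊆ gr M)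
    (hrG : M.eRk (G : Set α) = (q : ℕ∞)) (j : ℕ) :
    ∑ S ∈ (Rq M G q).filter (fun S : Finset α => (G \ S).card = j), (S.card - mTr M S) =
      (j + 1) * ((Rq M G q).filter (fun S : Finset α => (G \ S).card = j + 1)).card := by
  -- left: each term is `Σ_{x ∈ G} [x ∈ S ∧ eRk (S ∖ x) = q]`
  have hL : ∀ S ∈ (Rq M G q).filter (fun S : Finset α => (G \ S).card = j),
      S.card - mTr M S = ∑ x ∈ G, (if (x ∈ S ∧ M.eRk ((S.erase x : Finset α) : Set α) = (q : ℕ∞))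
        then 1 else 0) := by
    intro S hS
    have hS' := mem_Rq.1 (Finset.mem_filter.1 hS).1
    have hc := card_filter_eRk_erase_eq (hS'.1.trans hG) hS'.2
    rw [Finset.sum_boole]
    have hfilt : G.filter (fun y => y ∈ S ∧ M.eRk ((S.erase y : Finset α) : Set α) = (q : ℕ∞)) =
        S.filter (fun y => M.eRk ((S.erase y : Finset α) : Set α) = (q : ℕ∞)) := by
      ext y
      simp only [Finset.mem_filter]
      constructor
      · rintro ⟨-, hyS, h⟩
        exact ⟨hyS, h⟩
      · rintro ⟨hyS, h⟩
        exact ⟨hS'.1 hyS, hyS, h⟩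
    rw [hfilt, hc]
    simp
  -- right: `(j + 1)·#C_{j+1} = Σ_{x ∈ G} #{S′ ∈ C_{j+1} : x ∉ S′}`
  have hR : (j + 1) * ((Rq M G q).filter (fun S : Finset α => (G \ S).card = j + 1)).card =
      ∑ x ∈ G, ((Rq M G q).filter (fun S : Finset α => (G \ S).card = j + 1 ∧ x ∉ S)).card := by
    have h1 : ∀ S ∈ (Rq M G q).filter (fun S : Finset α => (G \ S).card = j + 1),
        (j + 1) = ∑ x ∈ G, (if x ∉ S then 1 else 0) := by
      intro S hS
      rw [Finset.mem_filter] at hS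
      rw [Finset.sum_boole, ← Finset.sdiff_eq_filter, hS.2]
      simp
    calc (j + 1) * ((Rq M G q).filter (fun S : Finset α => (G \ S).card = j + 1)).card
        = ∑ S ∈ (Rq M G q).filter (fun S : Finset α => (G \ S).card = j + 1), (j + 1) := by
          rw [Finset.sum_const, smul_eq_mul, mul_comm]
      _ = ∑ S ∈ (Rq M G q).filter (fun S : Finset α => (G \ S).card = j + 1),
            ∑ x ∈ G, (if x ∉ S then 1 else 0) := Finset.sum_congr rfl h1
      _ = ∑ x ∈ G, ∑ S ∈ (Rq M G q).filter (fun S : Finset α => (G \ S).card = j + 1),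
            (if x ∉ S then 1 else 0) := Finset.sum_comm
      _ = ∑ x ∈ G, ((Rq M G q).filter (fun S : Finset α => (G \ S).card = j + 1 ∧ x ∉ S)).card := by
          apply Finset.sum_congr rfl
          intro x _
          rw [Finset.sum_boole, Finset.filter_filter]
          simp
  rw [Finset.sum_congr rfl hL, Finset.sum_comm, hR]
  apply Finset.sum_congr rfl
  intro x hx
  rw [Finset.sum_boole, Finset.filter_filter, ← card_filter_nonColoop_eq hrG hx j]
  simp

/-- **The lower degree bound** on a simple matroid: `(d − j + 2)·#C_j ≤ (j + 1)·#C_{j+1}` for `j + 1 ≤ d`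
(`d = |G| − q`), since a spanning non-basis has at most `q − 2` coloops. -/
theorem succ_mul_card_ge (hs : Simple M) {G : Finset α} {q : ℕ} (hG : G ⊆ gr M)
    (hrG : M.eRk (G : Set α) = (q : ℕ∞)) (hq : 1 ≤ q) {j : ℕ} (hj : j + 1 ≤ G.card - q) :
    (G.card - q - j + 2) * ((Rq M G q).filter (fun S : Finset α => (G \ S).card = j)).card ≤
      (j + 1) * ((Rq M G q).filter (fun S : Finset α => (G \ S).card = j + 1)).card := by
  rw [← sum_card_sub_mTr_eq_succ_mul_card hG hrG j, mul_comm, Finset.card_eq_sum_ones, Finset.sum_mul]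
  apply Finset.sum_le_sum
  intro S hS
  rw [Finset.mem_filter] at hS
  have hS' := mem_Rq.1 hS.1
  have hsd := Finset.card_sdiff_of_subset hS'.1
  have hle := Finset.card_le_card hS'.1
  have hSq : q ≤ S.card := le_card_of_eRk_eq hS'.2
  have hlt : q < S.card := by omega
  have hm := mTr_add_two_le_of_spanning_nonbasis hs (hS'.1.trans hG) hS'.2 hq hlt
  rw [one_mul]
  omega

/-- **The type-`3` balance at corank `5`**: on a simple matroid, `0 ≤ J_3(G)` for every rank-`q` set `G` with
`4 ≤ q` and `|G| = q + 5`. -/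
theorem Jq_three_nonneg_of_card_eq_add_five (hs : Simple M) {G : Finset α} {q : ℕ} (hG : G ⊆ gr M)
    (hrG : M.eRk (G : Set α) = (q : ℕ∞)) (hq : 4 ≤ q) (hcard : G.card = q + 5) : 0 ≤ Jq M G q 3 := by
  apply Jq_three_nonneg_of_sizes hs hG hrG (by omega)
  set C : ℕ → Finset (Finset α) := fun j => (Rq M G q).filter (fun S : Finset α => (G \ S).card = j) with hC
  have hj5 : ∀ S ∈ Rq M G q, (G \ S).card ≤ 5 := by
    intro S hS
    have hS' := mem_Rq.1 hS
    have hSq : q ≤ S.card := le_card_of_eRk_eq hS'.2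
    rw [Finset.card_sdiff_of_subset hS'.1]
    omega
  have hterm : ∀ S ∈ Rq M G q,
      ((G.card : ℚ) + (q : ℚ) - 3 - 2 * (S.card : ℚ)) = 2 * ((G \ S).card : ℚ) - 8 := by
    intro S hS
    have hS' := mem_Rq.1 hS
    have hsd := Finset.card_sdiff_of_subset hS'.1
    have hle := Finset.card_le_card hS'.1
    have : ((G \ S).card : ℚ) = (G.card : ℚ) - (S.card : ℚ) := by
      rw [hsd]
      push_cast [hle]
      ring
    rw [this, hcard]
    push_cast
    ring
  rw [Finset.sum_congr rfl hterm]
  have hDF : ((C 0).card : ℚ) + ((C 1).card : ℚ) + ((C 2).card : ℚ) ≤ (DFq M G q 3 : ℚ) := by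
    have h01 : Disjoint (C 0) (C 1) := by
      rw [Finset.disjoint_filter]
      intro S _ h0 h1
      omega
    have h012 : Disjoint (C 0 ∪ C 1) (C 2) := by
      rw [Finset.disjoint_union_left]
      constructor <;> (rw [Finset.disjoint_filter]; intro S _ h0 h1; omega)
    have hsub : C 0 ∪ C 1 ∪ C 2 ⊆ (Rq M G q).filter (fun S : Finset α => (G \ S).card ≤ 2) := by
      intro S hS
      simp only [hC, Finset.mem_union, Finset.mem_filter] at hS ⊢
      rcases hS with (⟨h, h'⟩ | ⟨h, h'⟩) | ⟨h, h'⟩ <;> exact ⟨h, by omega⟩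
    have hcardU := Finset.card_le_card hsub
    rw [Finset.card_union_of_disjoint h012, Finset.card_union_of_disjoint h01] at hcardU
    have := card_filter_sdiff_le_two_le_DFq (M := M) (G := G) (q := q)
    exact_mod_cast hcardU.trans this
  have hsplit : ∑ S ∈ Rq M G q, (2 * ((G \ S).card : ℚ) - 8) =
      ∑ j ∈ Finset.range 6, ((C j).card : ℚ) * (2 * (j : ℚ) - 8) := by
    rw [← Finset.sum_fiberwise_of_maps_to (s := Rq M G q) (t := Finset.range 6)
      (g := fun S : Finset α => (G \ S).card) (fun S hS => Finset.mem_range.2 (by have := hj5 S hS; omega))]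
    apply Finset.sum_congr rfl
    intro j _
    rw [Finset.sum_congr rfl (fun S hS => by
      rw [(Finset.mem_filter.1 hS).2]), Finset.sum_const, nsmul_eq_mul]
  rw [hsplit, Finset.sum_range_succ, Finset.sum_range_succ, Finset.sum_range_succ,
    Finset.sum_range_succ, Finset.sum_range_succ, Finset.sum_range_one]
  have hC0 : (C 0).card = 1 := by
    have : C 0 = {G} := by
      ext S
      simp only [hC, Finset.mem_filter, mem_Rq, Finset.mem_singleton, Finset.card_eq_zero,
        Finset.sdiff_eq_empty_iff_subset]
      constructor
      · rintro ⟨⟨hSG, -⟩, hGS⟩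
        exact Finset.Subset.antisymm hSG hGS
      · rintro rfl
        exact ⟨⟨Finset.Subset.refl _, hrG⟩, Finset.Subset.refl _⟩
    rw [this, Finset.card_singleton]
  have hq1 : 1 ≤ q := by omega
  have hd : G.card - q = 5 := by omega
  -- the lower bounds (L) at j = 0, 1, 3, 4 and the upper bound (U) at j = 2
  have l0 := succ_mul_card_ge hs hG hrG hq1 (j := 0) (by omega)
  have l1 := succ_mul_card_ge hs hG hrG hq1 (j := 1) (by omega)
  have l3 := succ_mul_card_ge hs hG hrG hq1 (j := 3) (by omega)
  have l4 := succ_mul_card_ge hs hG hrG hq1 (j := 4) (by omega)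
  have u2 := succ_mul_card_le (M := M) hrG 2
  rw [hd] at l0 l1 l3 l4
  rw [hcard] at u2
  have l0' : (7 : ℚ) * ((C 0).card : ℚ) ≤ 1 * ((C 1).card : ℚ) := by
    have h : 7 * (C 0).card ≤ 1 * (C 1).card := by simpa [hC] using l0
    exact_mod_cast h
  have l1' : (6 : ℚ) * ((C 1).card : ℚ) ≤ 2 * ((C 2).card : ℚ) := by
    have h : 6 * (C 1).card ≤ 2 * (C 2).card := by simpa [hC] using l1
    exact_mod_cast h
  have l3' : (4 : ℚ) * ((C 3).card : ℚ) ≤ 4 * ((C 4).card : ℚ) := by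
    have h : 4 * (C 3).card ≤ 4 * (C 4).card := by simpa [hC] using l3
    exact_mod_cast h
  have l4' : (3 : ℚ) * ((C 4).card : ℚ) ≤ 5 * ((C 5).card : ℚ) := by
    have h : 3 * (C 4).card ≤ 5 * (C 5).card := by simpa [hC] using l4
    exact_mod_cast h
  have u2' : (3 : ℚ) * ((C 3).card : ℚ) ≤ ((q : ℚ) + 3) * ((C 2).card : ℚ) := by
    have h : 3 * (C 3).card ≤ (q + 3) * (C 2).card := by
      simpa [hC, show q + 5 - 2 = q + 3 by omega] using u2
    exact_mod_cast h
  have hq' : (4 : ℚ) ≤ (q : ℚ) := by exact_mod_cast hq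
  have hC0' : ((C 0).card : ℚ) = 1 := by exact_mod_cast hC0
  have hC1' : (0 : ℚ) ≤ ((C 1).card : ℚ) := by positivity
  have hC2' : (0 : ℚ) ≤ ((C 2).card : ℚ) := by positivity
  have hC3' : (0 : ℚ) ≤ ((C 3).card : ℚ) := by positivity
  have hq2 : (0 : ℚ) ≤ (q : ℚ) + 2 := by positivity
  have e1 := mul_le_mul_of_nonneg_left hDF hq2
  have e3 : 4 * ((C 1).card : ℚ) ≤ (q : ℚ) * ((C 1).card : ℚ) :=
    mul_le_mul_of_nonneg_right hq' hC1'
  have e4 : 4 * ((C 2).card : ℚ) ≤ (q : ℚ) * ((C 2).card : ℚ) :=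
    mul_le_mul_of_nonneg_right hq' hC2'
  push_cast
  nlinarith [e1, e3, e4, l0', l1', l3', l4', u2', hC0', hC1', hC2', hC3']

end PercRepro.Star
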